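import Mathlib

/-!
# The six-monomial Farkas obstruction, I: definitions and the link form
(blind cell PercRepro2, mine-1 g43; the kernel version of the k = 3 obstruction of mine-1 g42, MINE1-UNIONROW-K3.md §10–§11;
chain `UnionRowK3NoCertDefs` → `UnionRowK3NoCertLinksA` + `UnionRowK3NoCertLinksB` → `UnionRowK3NoCert`)

Setting (`UnionRowK3Cert`, `UnionRowPeel`): three observed vertices `u, v, w`, status cells `(σ_u, σ_v, σ_w) ∈ {T < N < S}³`
(27 cells), masses `m_c ≥ 0`, and the union-row form of a k = 3 instance `V = Σ_{c ∉ D} m_c (Z·1_A(c) − M(A)) (Z·1_B(c) − M(B))`,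
a cubic form in the masses.  The cell's k = 2 proof currency (`UnionRowFull`, `UnionRowK3Cert`, `UnionRowK3Mech`) writes
`V = Σ_j λ_j · m_{c_j} · slack_j + R` with `λ_j ≥ 0`, `R` a cubic with nonnegative coefficients and
`slack = M(S₁ ∩ S₂)·M(B) − M(S₁)·M(S₂)` an avoidance-PA fact: `B` a box on which the status law is positively associated
(`Γ`, `R_W = {σ_w ≠ T ∀ w ∈ W}`, `R'_W = {σ_w ≠ S ∀ w ∈ W}`), `S₁, S₂ ⊆ B` both up-closed or both down-closed inside `B`.
Such an identity proves `V ≥ 0` on every real status law.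

The chain proves that for the instance `X = Y = {u,v}` (cut cells `D = {σ_u = S, σ_v = T} ∪ {σ_u = T, σ_v = S}`),
`A = {σ_w = S}`, `B = {σ_v = S}` — in percolation words `f = 1[w ↔ s]`, `g = 1[v ↔ s]` with the union event
`{s ↮ {u,v}} ∪ {t ↮ {u,v}}`: the k = 2 union event with a functional of a third, SPECTATOR vertex — NO such identity exists
(`UnionRowK3NoCert.no_degree3_certificate`).  The witness is the 0/1 functional `y` on the six cubic monomials
`m_TTT m_TNS m_SNS, m_TTT m_TNS m_SSS, m_TTT m_TSS m_SNS, m_TTS m_TNT m_SSS, m_TTS m_TNS m_SST, m_TNS m_TSS m_STT`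
(the exact Farkas dual of the LP of mine-1 g42, `y·V = −1`, verified on all 8,410,824 columns by two codes).

ENCODING.  A cubic form is its coefficient tensor `F : Cell → Cell → Cell → ℚ` (the polynomial `Σ F a b c · m_a m_b m_c`);
two tensors define the same polynomial iff their symmetrisations `sym` agree (the coefficient of `m_a m_b m_c` is
`sym F a b c` up to the positive factor `1, 2, 6` of the monomial's symmetry), so a certificate identity is
`sym V = sym (Σ λ col + R)`.  The functional `y` is read off the symmetrised tensor, so it depends only on the polynomial.
The generator family is LARGER than the cell's: boxes are all product sets `Ru ×ˢ Rv ×ˢ Rw` whose coordinate sets contain `N`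
(64 of them; the 15 avoidance boxes are among them) and nested or trivial set pairs are allowed — a stronger non-existence
statement.  `N ∈` every coordinate set is exactly what the functional needs: on a `{T,S}³`-type box it would fail — the dual
exploits that positive association is never assumed on a slice `{σ_x = N}ᶜ`.

THIS FILE: `y` of a generator `m_c · slack(S₁,S₂,B)` is the LINK FORM
`Σ_{{a,b} : {c,a,b} ∈ supp y, a,b ∈ B} (1_{S₁}(a) − 1_{S₁}(b))·(1_{S₂}(a) − 1_{S₂}(b))` (`y_col_eq_LF`, from the pair identity
`pair`); complementing both sets inside the box does not change it (`LF_compl`); `y(V) = −1` (`y_V`); `y` is linear.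
-/

namespace Summit.Ventures.PercRepro2.UnionRowK3NoCert

open Finset

/-- a status cell `(σ_u, σ_v, σ_w)`, statuses `T = 0 < N = 1 < S = 2` -/
abbrev Cell := Fin 3 × Fin 3 × Fin 3

/-- the coefficient tensor of a cubic form in the 27 cell masses, `Σ_{a b c} F a b c · m_a m_b m_c` -/
abbrev Tensor := Cell → Cell → Cell → ℚ

/-- symmetrisation; `sym F = sym G` iff `F` and `G` define the same cubic polynomial -/
def sym (F : Tensor) : Tensor := fun a b c => F a b c + F a c b + F b a c + F b c a + F c a b + F c b a

/-- the indicator of a decidable proposition -/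
def ind (P : Prop) [Decidable P] : ℚ := if P then 1 else 0

/-- the indicator through `decide` -/
theorem ind_decide (P : Prop) [Decidable P] : ind P = if decide P then 1 else 0 := by
  simp [ind]

/-- the grid order: coordinatewise `T < N < S` -/
abbrev cle (a b : Cell) : Prop := a.1 ≤ b.1 ∧ a.2.1 ≤ b.2.1 ∧ a.2.2 ≤ b.2.2

/-- `A = {σ_w = S}` -/
abbrev inA (c : Cell) : Prop := c.2.2 = 2
/-- `B = {σ_v = S}` -/
abbrev inB (c : Cell) : Prop := c.2.1 = 2
/-- the cut set `D(X,Y)` for `X = Y = {u,v}`: `s` hits one of `u, v` and `t` the other -/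
abbrev inD (c : Cell) : Prop := (c.1 = 2 ∧ c.2.1 = 0) ∨ (c.1 = 0 ∧ c.2.1 = 2)

/-- the union-row form `V = Σ_{c ∉ D} m_c (Z·1_A(c) − M(A)) (Z·1_B(c) − M(B))` as a tensor:
`V c c₁ c₂ = 1[c ∉ D] (1_A(c) − 1_A(c₁)) (1_B(c) − 1_B(c₂))` -/
def V : Tensor := fun c c₁ c₂ => ind (¬ inD c) * (ind (inA c) - ind (inA c₁)) * (ind (inB c) - ind (inB c₂))

/-- the generator `m_c · (M(S₁ ∩ S₂)·M(B) − M(S₁)·M(S₂))` as a tensor -/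
def col (c : Cell) (B S₁ S₂ : Finset Cell) : Tensor := fun c' a b =>
  ind (c' = c) * (ind (a ∈ S₁ ∩ S₂) * ind (b ∈ B) - ind (a ∈ S₁) * ind (b ∈ S₂))

/-- an admissible box: a product set whose three coordinate sets all contain `N`
(the 15 avoidance boxes `Γ`, `R_W`, `R'_W` are the products of `{T,N,S}`, `{N,S}`, `{T,N}`) -/
def IsBox (B : Finset Cell) : Prop :=
  ∃ Ru Rv Rw : Finset (Fin 3), 1 ∈ Ru ∧ 1 ∈ Rv ∧ 1 ∈ Rw ∧ B = Ru ×ˢ Rv ×ˢ Rw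

/-- `S ⊆ B` is up-closed inside `B` -/
def UpIn (B S : Finset Cell) : Prop := S ⊆ B ∧ ∀ a ∈ S, ∀ b ∈ B, cle a b → b ∈ S
/-- `S ⊆ B` is down-closed inside `B` -/
def DownIn (B S : Finset Cell) : Prop := S ⊆ B ∧ ∀ a ∈ S, ∀ b ∈ B, cle b a → b ∈ S

/-- an admissible generator: a cell multiplier `c`, a box `B`, and two sets both up-closed or both down-closed in `B` -/
structure Gen where
  c : Cell
  B : Finset Cell
  S₁ : Finset Cell
  S₂ : Finset Cell
  box : IsBox B
  mono : (UpIn B S₁ ∧ UpIn B S₂) ∨ (DownIn B S₁ ∧ DownIn B S₂)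

/-- the six-monomial functional on symmetrised tensors: the sum of the coefficients of
`m_TTT m_TNS m_SNS, m_TTT m_TNS m_SSS, m_TTT m_TSS m_SNS, m_TTS m_TNT m_SSS, m_TTS m_TNS m_SST, m_TNS m_TSS m_STT` -/
def ysym (G : Tensor) : ℚ :=
  G ((0 : Fin 3), (0 : Fin 3), (0 : Fin 3)) ((0 : Fin 3), (1 : Fin 3), (2 : Fin 3)) ((2 : Fin 3), (1 : Fin 3), (2 : Fin 3)) + G ((0 : Fin 3), (0 : Fin 3), (0 : Fin 3)) ((0 : Fin 3), (1 : Fin 3), (2 : Fin 3)) ((2 : Fin 3), (2 : Fin 3), (2 : Fin 3)) + G ((0 : Fin 3), (0 : Fin 3), (0 : Fin 3)) ((0 : Fin 3), (2 : Fin 3), (2 : Fin 3)) ((2 : Fin 3), (1 : Fin 3), (2 : Fin 3)) + G ((0 : Fin 3), (0 : Fin 3), (2 : Fin 3)) ((0 : Fin 3), (1 : Fin 3), (0 : Fin 3)) ((2 : Fin 3), (2 : Fin 3), (2 : Fin 3)) + G ((0 : Fin 3), (0 : Fin 3), (2 : Fin 3)) ((0 : Fin 3), (1 : Fin 3), (2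 : Fin 3)) ((2 : Fin 3), (2 : Fin 3), (0 : Fin 3)) + G ((0 : Fin 3), (1 : Fin 3), (2 : Fin 3)) ((0 : Fin 3), (2 : Fin 3), (2 : Fin 3)) ((2 : Fin 3), (0 : Fin 3), (0 : Fin 3))

/-- the functional on cubic forms: `y F = ysym (sym F)` depends only on the polynomial of `F` -/
def y (F : Tensor) : ℚ := ysym (sym F)

/-- the pair term `1[a,b ∈ B]·(1_{S₁}(a) − 1_{S₁}(b))·(1_{S₂}(a) − 1_{S₂}(b))` -/
def pt (B S₁ S₂ : Finset Cell) (a b : Cell) : ℚ :=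
  ind (a ∈ B ∧ b ∈ B) * (ind (a ∈ S₁) - ind (b ∈ S₁)) * (ind (a ∈ S₂) - ind (b ∈ S₂))

/-- the link form of `y (col c B S₁ S₂)`: the pair terms of the monomials containing `c` -/
def LF (c : Cell) (B S₁ S₂ : Finset Cell) : ℚ :=
  ind (((0 : Fin 3), (0 : Fin 3), (0 : Fin 3)) = c) * pt B S₁ S₂ ((0 : Fin 3), (1 : Fin 3), (2 : Fin 3)) ((2 : Fin 3), (1 : Fin 3), (2 : Fin 3)) +
  ind (((0 : Fin 3), (1 : Fin 3), (2 : Fin 3)) = c) * pt B S₁ S₂ ((0 : Fin 3), (0 : Fin 3), (0 : Fin 3)) ((2 : Fin 3), (1 : Fin 3), (2 : Fin 3)) +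
  ind (((2 : Fin 3), (1 : Fin 3), (2 : Fin 3)) = c) * pt B S₁ S₂ ((0 : Fin 3), (0 : Fin 3), (0 : Fin 3)) ((0 : Fin 3), (1 : Fin 3), (2 : Fin 3)) +
  ind (((0 : Fin 3), (0 : Fin 3), (0 : Fin 3)) = c) * pt B S₁ S₂ ((0 : Fin 3), (1 : Fin 3), (2 : Fin 3)) ((2 : Fin 3), (2 : Fin 3), (2 : Fin 3)) +
  ind (((0 : Fin 3), (1 : Fin 3), (2 : Fin 3)) = c) * pt B S₁ S₂ ((0 : Fin 3), (0 : Fin 3), (0 : Fin 3)) ((2 : Fin 3), (2 : Fin 3), (2 : Fin 3)) +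
  ind (((2 : Fin 3), (2 : Fin 3), (2 : Fin 3)) = c) * pt B S₁ S₂ ((0 : Fin 3), (0 : Fin 3), (0 : Fin 3)) ((0 : Fin 3), (1 : Fin 3), (2 : Fin 3)) +
  ind (((0 : Fin 3), (0 : Fin 3), (0 : Fin 3)) = c) * pt B S₁ S₂ ((0 : Fin 3), (2 : Fin 3), (2 : Fin 3)) ((2 : Fin 3), (1 : Fin 3), (2 : Fin 3)) +
  ind (((0 : Fin 3), (2 : Fin 3), (2 : Fin 3)) = c) * pt B S₁ S₂ ((0 : Fin 3), (0 : Fin 3), (0 : Fin 3)) ((2 : Fin 3), (1 : Fin 3), (2 : Fin 3)) +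
  ind (((2 : Fin 3), (1 : Fin 3), (2 : Fin 3)) = c) * pt B S₁ S₂ ((0 : Fin 3), (0 : Fin 3), (0 : Fin 3)) ((0 : Fin 3), (2 : Fin 3), (2 : Fin 3)) +
  ind (((0 : Fin 3), (0 : Fin 3), (2 : Fin 3)) = c) * pt B S₁ S₂ ((0 : Fin 3), (1 : Fin 3), (0 : Fin 3)) ((2 : Fin 3), (2 : Fin 3), (2 : Fin 3)) +
  ind (((0 : Fin 3), (1 : Fin 3), (0 : Fin 3)) = c) * pt B S₁ S₂ ((0 : Fin 3), (0 : Fin 3), (2 : Fin 3)) ((2 : Fin 3), (2 : Fin 3), (2 : Fin 3)) +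
  ind (((2 : Fin 3), (2 : Fin 3), (2 : Fin 3)) = c) * pt B S₁ S₂ ((0 : Fin 3), (0 : Fin 3), (2 : Fin 3)) ((0 : Fin 3), (1 : Fin 3), (0 : Fin 3)) +
  ind (((0 : Fin 3), (0 : Fin 3), (2 : Fin 3)) = c) * pt B S₁ S₂ ((0 : Fin 3), (1 : Fin 3), (2 : Fin 3)) ((2 : Fin 3), (2 : Fin 3), (0 : Fin 3)) +
  ind (((0 : Fin 3), (1 : Fin 3), (2 : Fin 3)) = c) * pt B S₁ S₂ ((0 : Fin 3), (0 : Fin 3), (2 : Fin 3)) ((2 : Fin 3), (2 : Fin 3), (0 : Fin 3)) +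
  ind (((2 : Fin 3), (2 : Fin 3), (0 : Fin 3)) = c) * pt B S₁ S₂ ((0 : Fin 3), (0 : Fin 3), (2 : Fin 3)) ((0 : Fin 3), (1 : Fin 3), (2 : Fin 3)) +
  ind (((0 : Fin 3), (1 : Fin 3), (2 : Fin 3)) = c) * pt B S₁ S₂ ((0 : Fin 3), (2 : Fin 3), (2 : Fin 3)) ((2 : Fin 3), (0 : Fin 3), (0 : Fin 3)) +
  ind (((0 : Fin 3), (2 : Fin 3), (2 : Fin 3)) = c) * pt B S₁ S₂ ((0 : Fin 3), (1 : Fin 3), (2 : Fin 3)) ((2 : Fin 3), (0 : Fin 3), (0 : Fin 3)) +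
  ind (((2 : Fin 3), (0 : Fin 3), (0 : Fin 3)) = c) * pt B S₁ S₂ ((0 : Fin 3), (1 : Fin 3), (2 : Fin 3)) ((0 : Fin 3), (2 : Fin 3), (2 : Fin 3))

/-- the pair identity behind the link form (only `S₁, S₂ ⊆ B` is used) -/
theorem pair {B S₁ S₂ : Finset Cell} (h₁ : S₁ ⊆ B) (h₂ : S₂ ⊆ B) (a b : Cell) :
    (ind (a ∈ S₁ ∩ S₂) * ind (b ∈ B) - ind (a ∈ S₁) * ind (b ∈ S₂)) +
      (ind (b ∈ S₁ ∩ S₂) * ind (a ∈ B) - ind (b ∈ S₁) * ind (a ∈ S₂)) =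
    ind (a ∈ B ∧ b ∈ B) * (ind (a ∈ S₁) - ind (b ∈ S₁)) * (ind (a ∈ S₂) - ind (b ∈ S₂)) := by
  simp only [ind, Finset.mem_inter]
  by_cases haB : a ∈ B <;> by_cases hbB : b ∈ B <;> by_cases ha1 : a ∈ S₁ <;> by_cases ha2 : a ∈ S₂ <;>
    by_cases hb1 : b ∈ S₁ <;> by_cases hb2 : b ∈ S₂ <;>
    first
    | exact absurd (h₁ ha1) haB
    | exact absurd (h₂ ha2) haB
    | exact absurd (h₁ hb1) hbB
    | exact absurd (h₂ hb2) hbB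
    | simp [haB, hbB, ha1, ha2, hb1, hb2]

/-- `y` of a generator is its link form -/
theorem y_col_eq_LF {B S₁ S₂ : Finset Cell} (h₁ : S₁ ⊆ B) (h₂ : S₂ ⊆ B) (c : Cell) :
    y (col c B S₁ S₂) = LF c B S₁ S₂ := by
  simp only [y, ysym, sym, col, LF, pt]
  linear_combination
    ind (((0 : Fin 3), (0 : Fin 3), (0 : Fin 3)) = c) * pair h₁ h₂ ((0 : Fin 3), (1 : Fin 3), (2 : Fin 3)) ((2 : Fin 3), (1 : Fin 3), (2 : Fin 3)) +
    ind (((0 : Fin 3), (1 : Fin 3), (2 : Fin 3)) = c) * pair h₁ h₂ ((0 : Fin 3), (0 : Fin 3), (0 : Fin 3)) ((2 : Fin 3), (1 : Fin 3), (2 : Fin 3)) +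
    ind (((2 : Fin 3), (1 : Fin 3), (2 : Fin 3)) = c) * pair h₁ h₂ ((0 : Fin 3), (0 : Fin 3), (0 : Fin 3)) ((0 : Fin 3), (1 : Fin 3), (2 : Fin 3)) +
    ind (((0 : Fin 3), (0 : Fin 3), (0 : Fin 3)) = c) * pair h₁ h₂ ((0 : Fin 3), (1 : Fin 3), (2 : Fin 3)) ((2 : Fin 3), (2 : Fin 3), (2 : Fin 3)) +
    ind (((0 : Fin 3), (1 : Fin 3), (2 : Fin 3)) = c) * pair h₁ h₂ ((0 : Fin 3), (0 : Fin 3), (0 : Fin 3)) ((2 : Fin 3), (2 : Fin 3), (2 : Fin 3)) +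
    ind (((2 : Fin 3), (2 : Fin 3), (2 : Fin 3)) = c) * pair h₁ h₂ ((0 : Fin 3), (0 : Fin 3), (0 : Fin 3)) ((0 : Fin 3), (1 : Fin 3), (2 : Fin 3)) +
    ind (((0 : Fin 3), (0 : Fin 3), (0 : Fin 3)) = c) * pair h₁ h₂ ((0 : Fin 3), (2 : Fin 3), (2 : Fin 3)) ((2 : Fin 3), (1 : Fin 3), (2 : Fin 3)) +
    ind (((0 : Fin 3), (2 : Fin 3), (2 : Fin 3)) = c) * pair h₁ h₂ ((0 : Fin 3), (0 : Fin 3), (0 : Fin 3)) ((2 : Fin 3), (1 : Fin 3), (2 : Fin 3)) +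
    ind (((2 : Fin 3), (1 : Fin 3), (2 : Fin 3)) = c) * pair h₁ h₂ ((0 : Fin 3), (0 : Fin 3), (0 : Fin 3)) ((0 : Fin 3), (2 : Fin 3), (2 : Fin 3)) +
    ind (((0 : Fin 3), (0 : Fin 3), (2 : Fin 3)) = c) * pair h₁ h₂ ((0 : Fin 3), (1 : Fin 3), (0 : Fin 3)) ((2 : Fin 3), (2 : Fin 3), (2 : Fin 3)) +
    ind (((0 : Fin 3), (1 : Fin 3), (0 : Fin 3)) = c) * pair h₁ h₂ ((0 : Fin 3), (0 : Fin 3), (2 : Fin 3)) ((2 : Fin 3), (2 : Fin 3), (2 : Fin 3)) +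
    ind (((2 : Fin 3), (2 : Fin 3), (2 : Fin 3)) = c) * pair h₁ h₂ ((0 : Fin 3), (0 : Fin 3), (2 : Fin 3)) ((0 : Fin 3), (1 : Fin 3), (0 : Fin 3)) +
    ind (((0 : Fin 3), (0 : Fin 3), (2 : Fin 3)) = c) * pair h₁ h₂ ((0 : Fin 3), (1 : Fin 3), (2 : Fin 3)) ((2 : Fin 3), (2 : Fin 3), (0 : Fin 3)) +
    ind (((0 : Fin 3), (1 : Fin 3), (2 : Fin 3)) = c) * pair h₁ h₂ ((0 : Fin 3), (0 : Fin 3), (2 : Fin 3)) ((2 : Fin 3), (2 : Fin 3), (0 : Fin 3)) +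
    ind (((2 : Fin 3), (2 : Fin 3), (0 : Fin 3)) = c) * pair h₁ h₂ ((0 : Fin 3), (0 : Fin 3), (2 : Fin 3)) ((0 : Fin 3), (1 : Fin 3), (2 : Fin 3)) +
    ind (((0 : Fin 3), (1 : Fin 3), (2 : Fin 3)) = c) * pair h₁ h₂ ((0 : Fin 3), (2 : Fin 3), (2 : Fin 3)) ((2 : Fin 3), (0 : Fin 3), (0 : Fin 3)) +
    ind (((0 : Fin 3), (2 : Fin 3), (2 : Fin 3)) = c) * pair h₁ h₂ ((0 : Fin 3), (1 : Fin 3), (2 : Fin 3)) ((2 : Fin 3), (0 : Fin 3), (0 : Fin 3)) +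
    ind (((2 : Fin 3), (0 : Fin 3), (0 : Fin 3)) = c) * pair h₁ h₂ ((0 : Fin 3), (1 : Fin 3), (2 : Fin 3)) ((0 : Fin 3), (2 : Fin 3), (2 : Fin 3))

/-- complementing both sets inside the box leaves every pair term unchanged -/
theorem pt_compl {B S₁ S₂ : Finset Cell} (a b : Cell) :
    pt B (B \ S₁) (B \ S₂) a b = pt B S₁ S₂ a b := by
  simp only [pt, ind, Finset.mem_sdiff]
  by_cases haB : a ∈ B <;> by_cases hbB : b ∈ B <;> by_cases ha1 : a ∈ S₁ <;> by_cases ha2 : a ∈ S₂ <;>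
    by_cases hb1 : b ∈ S₁ <;> by_cases hb2 : b ∈ S₂ <;> simp [haB, hbB, ha1, ha2, hb1, hb2]

/-- complementing both sets inside the box leaves the link form unchanged -/
theorem LF_compl {B S₁ S₂ : Finset Cell} (c : Cell) :
    LF c B (B \ S₁) (B \ S₂) = LF c B S₁ S₂ := by
  simp only [LF, pt_compl]

/-- the complement inside the box of a down-closed set is up-closed -/
theorem upIn_sdiff {B S : Finset Cell} (h : DownIn B S) : UpIn B (B \ S) := by
  refine ⟨Finset.sdiff_subset, ?_⟩
  intro a ha b hb hab
  rw [Finset.mem_sdiff] at ha ⊢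
  exact ⟨hb, fun hbS => ha.2 (h.2 b hbS a ha.1 hab)⟩

/-- `y(V) = −1`: the functional is negative on the row -/
theorem y_V : y V = -1 := by
  decide +kernel

/-- `y` is nonnegative on a tensor with nonnegative entries -/
theorem y_nonneg_of_nonneg {F : Tensor} (h : ∀ a b c, 0 ≤ F a b c) : 0 ≤ y F := by
  simp only [y, ysym, sym]
  repeat' apply add_nonneg
  all_goals exact h _ _ _

/-- `y` is additive -/
theorem y_add (F G : Tensor) : y (fun a b c => F a b c + G a b c) = y F + y G := by
  simp only [y, ysym, sym]; ring

/-- `y` is homogeneous -/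
theorem y_smul (t : ℚ) (F : Tensor) : y (fun a b c => t * F a b c) = t * y F := by
  simp only [y, ysym, sym]; ring

/-- `y` commutes with finite sums -/
theorem y_sum {n : ℕ} (F : Fin n → Tensor) : y (fun a b c => ∑ i, F i a b c) = ∑ i, y (F i) := by
  simp only [y, ysym, sym, Finset.sum_add_distrib]

end Summit.Ventures.PercRepro2.UnionRowK3NoCert
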